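import Mathlib
import HarnessLib
import Literature.Computability.Complexity.KWProtocol
import Literature.Computability.Complexity.KRWComposition
import Literature.Computability.Complexity.Circuit
import Literature.Computability.Complexity.CircuitComposition
import Literature.Computability.MetaComplexity.Hirahara2020.SmallBPYesDisjoint

/-!
# The KRW iteration: a hard function with a small circuit from the weak KRW conjecture

Support file for item stmt-PneNP-18541 (`CompositionIteration`, route `KrwChromaticSteering`):
the content of the registered stubs `stub_iterate` (the KRW95 §5 iteration) and `stub_circuit`
(small `B₂`-circuits for iterated compositions) of the birth skeleton, merged into ONE
definition-free statement `exists_hard_function_of_weakKRW`: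

> from the weak KRW conjecture in depth form (constant `c`), for every `c₀` there are `N ≥ 1`, a
> function `h : {0,1}^N → {0,1}`, a `B₂`-circuit `C` computing `h` and a number `S ≥ 1` with
> `⌊log₂(N + |C|)⌋ ≤ 4 S` such that EVERY protocol for the Karchmer–Wigderson game of `h` has
> depth `> c₀ · S`.

Proof (Karchmer–Raz–Wigderson 1995, §5; Meir 2023, §1 Prop. 1 — folklore): take `d = c₀ + 1`
levels and inner arity `k = 2^t` with `(c d² + c₀ d)(t+1) < 2^t`; starting from `h₀ = x₀` on one
bit, put `h_{j+1} = h_j ⋄ g_{j+1}` on `k^j · k` bits (row-major, `finProdFinEquiv`), `g_{j+1}` the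
inner function the conjecture provides for `h_j`. By induction on `j ≤ d` we carry (i) `h_j` is
non-constant, (ii) every protocol for `KW_{h_j}` has depth `≥ j·k − j·c·d·(t+1)`, (iii) `h_j` has a
`B₂`-program of `≤ j · k^j · univBound k` gates (Shannon expansion for each copy of an inner
function, `cktSize_univ_fin`, composed with `CktSize.comp` / `pi_const`; the bound
`univBound k ≤ 2^(k+3)` is the tree's `Hirahara2020.univBound_le_two_pow`). Non-constancy propagates
because a constant `h_{j+1}` would be solved by a depth-`0` leaf, forcing `k ≤ c·d·(t+1)`.
Nothing here bears on P vs NP (a conditional glue step; the hypothesis is an open conjecture).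
-/

set_option linter.dupNamespace false -- `Summit.PneNP.PneNP.…`: summit = sub-problem name (D-0017 single-conjunct layout)

namespace Summit.PneNP.PneNP.Theorems.KrwCompositionIteration

open Literature.Computability.Complexity

universe u v

/-! ### Protocol transfer along input embeddings -/

/-- **Pull-back of a protocol along an embedding of inputs.** If `φ` maps inputs of `h'` to inputs
of `h` with `h (φ x) = h' x`, and embedded inputs differ only at coordinates `i` whose preimages
`back i` differ, then a protocol for `KW_h` relabelled by `KWTree.comap φ φ back` solves `KW_{h'}`
(in the same depth, `KWTree.depth_comap`). -/
theorem solves_comap_of_embedding {ι : Type u} {κ : Type v} {h : (κ → Bool) → Bool}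
    {h' : (ι → Bool) → Bool} {P : KWTree κ} (hP : P.Solves h)
    (φ : (ι → Bool) → (κ → Bool)) (back : κ → ι) (he : ∀ x, h (φ x) = h' x)
    (hback : ∀ x y : ι → Bool, ∀ i : κ, φ x i ≠ φ y i → x (back i) ≠ y (back i)) :
    (P.comap φ φ back).Solves h' := by
  intro x y hx hy
  rw [KWTree.run_comap]
  refine hback x y _ (hP (φ x) (φ y) ?_ ?_)
  · rw [he]; exact hx
  · rw [he]; exact hy

/-- A constant function has a vacuous KW game: every tree solves it. -/
theorem solves_of_forall_eq {ι : Type u} (P : KWTree ι) {h : (ι → Bool) → Bool}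
    (hc : ∀ a b, h a = h b) : P.Solves h := by
  intro a b ha hb
  rw [hc a b, hb] at ha
  exact absurd ha (by simp)

/-! ### One level of composition, row-major on `Fin (m * n)` -/

/-- A protocol for the row-major composed function `x ↦ (h ⋄ g)(X)`, `X (i, j) = x ⟨i·n + j⟩`
(`finProdFinEquiv`), is a protocol for `KW_{h ⋄ g}` on matrices, of the same depth. -/
theorem exists_solves_blockComp_of_rowMajor {m n : ℕ} (h : (Fin m → Bool) → Bool)
    (g : (Fin n → Bool) → Bool) (Q : KWTree (Fin (m * n)))
    (hQ : Q.Solves fun x => blockComp h g fun p => x (finProdFinEquiv p)) :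
    ∃ P : KWTree (Fin m × Fin n), P.Solves (blockComp h g) ∧ P.depth = Q.depth := by
  refine ⟨Q.comap (fun X q => X (finProdFinEquiv.symm q)) (fun X q => X (finProdFinEquiv.symm q))
    finProdFinEquiv.symm, ?_, KWTree.depth_comap _ _ _ Q⟩
  refine solves_comap_of_embedding hQ _ _ (fun X => ?_) (fun X Y q hq => hq)
  simp only [Equiv.symm_apply_apply]

/-- A `B₂`-program for `h` of `s` gates gives one for the row-major composed function `h ⋄ g` on
`m · n` bits of `m · univBound n + s` gates (one Shannon-expansion circuit per row for `g`, then
the program for `h`). -/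
theorem cktSize_blockComp_rowMajor {m n s : ℕ} {h : (Fin m → Bool) → Bool}
    (g : (Fin n → Bool) → Bool) (hh : CktSize B2 (fun x (_ : Unit) => h x) s) :
    CktSize B2 (fun (x : Fin (m * n) → Bool) (_ : Unit) =>
      blockComp h g (fun p => x (finProdFinEquiv p))) (m * univBound n + s) := by
  have hF : CktSize B2 (fun (x : Fin (m * n) → Bool) (i : Fin m) =>
      g (fun j => x (finProdFinEquiv (i, j)))) (m * univBound n) := by
    have := CktSize.pi_const (κ := Fin m)
      (f := fun (x : Fin (m * n) → Bool) (i : Fin m) => g (fun j => x (finProdFinEquiv (i, j))))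
      (fun i => (cktSize_univ_fin n (fun y (_ : Unit) => g y)).rewire
        (fun j => finProdFinEquiv (i, j)))
    simpa using this
  exact (hF.comp hh).congr fun x _ => rfl

/-! ### Arithmetic of the parameters -/

/-- `⌊log₂ (k^(j+1))⌋ + 1 ≤ (j+1) · (⌊log₂ k⌋ + 1)`. -/
theorem log_pow_succ_le (k j : ℕ) :
    Nat.log 2 (k ^ (j + 1)) + 1 ≤ (j + 1) * (Nat.log 2 k + 1) := by
  have hk : k < 2 ^ (Nat.log 2 k + 1) := Nat.lt_pow_succ_log_self (by norm_num) k
  have h1 : k ^ (j + 1) < (2 ^ (Nat.log 2 k + 1)) ^ (j + 1) :=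
    Nat.pow_lt_pow_left hk (Nat.succ_ne_zero j)
  rw [← pow_mul] at h1
  have h2 : Nat.log 2 (k ^ (j + 1)) < (Nat.log 2 k + 1) * (j + 1) :=
    Nat.log_lt_of_lt_pow' (Nat.mul_ne_zero (Nat.succ_ne_zero _) (Nat.succ_ne_zero _)) h1
  rw [Nat.mul_comm] at h2
  omega

/-- For every `A` there is `t` with `A · (t + 1) < 2^t` (take `t = 2A + 4`). -/
theorem exists_mul_succ_lt_two_pow (A : ℕ) : ∃ t : ℕ, A * (t + 1) < 2 ^ t := by
  refine ⟨2 * A + 4, ?_⟩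
  have hA : A < 2 ^ A := Nat.lt_two_pow_self
  have h1 : 2 * A + 4 + 1 ≤ 2 ^ (A + 4) := by
    rw [pow_add]; norm_num; omega
  calc A * (2 * A + 4 + 1) ≤ A * 2 ^ (A + 4) := Nat.mul_le_mul_left A h1
    _ < 2 ^ A * 2 ^ (A + 4) := Nat.mul_lt_mul_of_pos_right hA (by positivity)
    _ = 2 ^ (2 * A + 4) := by rw [← pow_add]; ring_nf

/-! ### The iteration -/

/-- **The KRW iteration, level by level.** Under the weak KRW conjecture with constant `c`, for
inner arity `k ≥ 1` and a number of levels `d` with `c · d · (⌊log₂ k⌋+1) < k`, for every `j ≤ d`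
there is a function `h_j` on `k^j` bits which is non-constant, whose KW game needs depth
`≥ j·k − j·c·d·(⌊log₂ k⌋+1)`, and which has a `B₂`-program of `≤ j · k^j · univBound k` gates. -/
theorem iterate_levels {c : ℕ}
    (hweak : ∀ m n : ℕ, 1 ≤ n → ∀ f : (Fin m → Bool) → Bool, (∃ a b, f a ≠ f b) →
      ∃ g : (Fin n → Bool) → Bool, ∀ P : KWTree (Fin m × Fin n), P.Solves (blockComp f g) →
        ∃ Q : KWTree (Fin m), Q.Solves f ∧ Q.depth + n ≤ P.depth + c * (Nat.log 2 (m * n) + 1))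
    {k d : ℕ} (hk : 1 ≤ k) (hB : c * (d * (Nat.log 2 k + 1)) < k) :
    ∀ j : ℕ, j ≤ d → ∃ N : ℕ, N = k ^ j ∧ ∃ h : (Fin N → Bool) → Bool,
      (∃ a b, h a ≠ h b) ∧
      (∀ Q : KWTree (Fin N), Q.Solves h → j * k ≤ Q.depth + j * (c * (d * (Nat.log 2 k + 1)))) ∧
      CktSize B2 (fun x (_ : Unit) => h x) (j * (N * univBound k))
  | 0, _ => by
    refine ⟨1, (pow_zero k).symm, fun x => x 0, ⟨fun _ => true, fun _ => false, by simp⟩,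
      fun Q _ => by simp, ?_⟩
    simpa using CktSize.proj B2 (fun _ : Unit => (0 : Fin 1))
  | j + 1, hj => by
    obtain ⟨N, hN, h, hnc, hlb, hck⟩ := iterate_levels hweak hk hB j (Nat.le_of_succ_le hj)
    obtain ⟨g, hg⟩ := hweak N k hk h hnc
    -- per-level loss: `c (⌊log₂ (N k)⌋ + 1) ≤ c d (⌊log₂ k⌋ + 1)`
    have hloss : c * (Nat.log 2 (N * k) + 1) ≤ c * (d * (Nat.log 2 k + 1)) := by
      refine Nat.mul_le_mul_left c ?_
      rw [hN, ← pow_succ]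
      exact (log_pow_succ_le k j).trans (Nat.mul_le_mul_right _ hj)
    -- the new function `h' = h ⋄ g`, row-major on `N * k` bits
    have hlb' : ∀ Q : KWTree (Fin (N * k)),
        Q.Solves (fun x => blockComp h g fun p => x (finProdFinEquiv p)) →
          (j + 1) * k ≤ Q.depth + (j + 1) * (c * (d * (Nat.log 2 k + 1))) := by
      intro Q hQ
      obtain ⟨P, hP, hPd⟩ := exists_solves_blockComp_of_rowMajor h g Q hQ
      obtain ⟨Q₀, hQ₀, hd⟩ := hg P hP
      have ih := hlb Q₀ hQ₀
      rw [hPd] at hd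
      rw [Nat.succ_mul, Nat.succ_mul]
      omega
    have hnc' : ∃ a b, (fun x : Fin (N * k) → Bool => blockComp h g fun p => x (finProdFinEquiv p)) a ≠
        (fun x : Fin (N * k) → Bool => blockComp h g fun p => x (finProdFinEquiv p)) b := by
      by_contra hall
      have hNk : 0 < N * k := by
        rw [hN, ← pow_succ]; exact Nat.pow_pos hk
      have hsol := solves_of_forall_eq (KWTree.leaf (⟨0, hNk⟩ : Fin (N * k)))
        (h := fun x : Fin (N * k) → Bool => blockComp h g fun p => x (finProdFinEquiv p))
        (fun a b => by by_contra hab; exact hall ⟨a, b, hab⟩)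
      have h1 := hlb' _ hsol
      rw [KWTree.depth_leaf, zero_add] at h1
      have h2 : k ≤ c * (d * (Nat.log 2 k + 1)) := Nat.le_of_mul_le_mul_left h1 (Nat.succ_pos j)
      omega
    refine ⟨N * k, by rw [hN, pow_succ], _, hnc', hlb', ?_⟩
    refine (cktSize_blockComp_rowMajor g hck).of_le ?_
    have hNU : N * univBound k ≤ N * k * univBound k :=
      Nat.mul_le_mul_right _ (Nat.le_mul_of_pos_right N hk)
    calc N * univBound k + j * (N * univBound k) = (j + 1) * (N * univBound k) := by ring
      _ ≤ (j + 1) * (N * k * univBound k) := Nat.mul_le_mul_left _ hNU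

/-- **A hard function with a small circuit** (the KRW iteration, assembled; stubs `stub_iterate`
+ `stub_circuit` of the birth skeleton in definition-free form). Under the weak KRW conjecture in
depth form (constant `c`): for every `c₀` there are `N ≥ 1`, `h : {0,1}^N → {0,1}`, a `B₂`-circuit
`C` computing `h`, and `S ≥ 1` with `⌊log₂(N + |C|)⌋ ≤ 4 S`, such that every protocol tree solving
`KW_h` has depth `> c₀ · S`. (`d = c₀ + 1` levels, `k = 2^t` with `(c d² + c₀ d)(t+1) < 2^t`,
`S = k + d (t + 1)`, `N = k^d`.) -/
theorem exists_hard_function_of_weakKRW {c : ℕ}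
    (hweak : ∀ m n : ℕ, 1 ≤ n → ∀ f : (Fin m → Bool) → Bool, (∃ a b, f a ≠ f b) →
      ∃ g : (Fin n → Bool) → Bool, ∀ P : KWTree (Fin m × Fin n), P.Solves (blockComp f g) →
        ∃ Q : KWTree (Fin m), Q.Solves f ∧ Q.depth + n ≤ P.depth + c * (Nat.log 2 (m * n) + 1))
    (c₀ : ℕ) :
    ∃ N : ℕ, 1 ≤ N ∧ ∃ h : (Fin N → Bool) → Bool, ∃ C : Circuit (Fin N),
      C.IsOver B2 ∧ C.Computes h ∧ ∃ S : ℕ, 1 ≤ S ∧ Nat.log 2 (N + C.size) ≤ 4 * S ∧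
        ∀ P : KWTree (Fin N), P.Solves h → c₀ * S < P.depth := by
  set d : ℕ := c₀ + 1 with hd
  obtain ⟨t, ht⟩ := exists_mul_succ_lt_two_pow (c * (d * d) + c₀ * d)
  set k : ℕ := 2 ^ t with hkdef
  have hk : 1 ≤ k := Nat.one_le_two_pow
  have hlog : Nat.log 2 k = t := Nat.log_pow (by norm_num) t
  have hsplit : (c * (d * d) + c₀ * d) * (t + 1) = d * (c * (d * (t + 1))) + c₀ * d * (t + 1) := by
    ring
  have hB : c * (d * (Nat.log 2 k + 1)) < k := by
    rw [hlog]
    have h1 : c * (d * (t + 1)) ≤ d * (c * (d * (t + 1))) := Nat.le_mul_of_pos_left _ (by omega)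
    omega
  obtain ⟨N, hN, h, _, hlb, hck⟩ := iterate_levels hweak hk hB d le_rfl
  obtain ⟨C, hCO, hCs, hCe⟩ := hck.toCircuit
  have hN1 : 1 ≤ N := by rw [hN]; exact Nat.one_le_pow _ _ hk
  refine ⟨N, hN1, h, C, hCO, fun x => hCe x, k + d * (t + 1), by omega, ?_, fun P hP => ?_⟩
  · -- `N + |C| ≤ k^d (1 + d · univBound k) ≤ 2^(t d) · 2^d · 2^(k+3)`
    have hU : univBound k ≤ 2 ^ (k + 3) :=
      Literature.Computability.MetaComplexity.Hirahara2020.univBound_le_two_pow k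
    have hd2 : d + 1 ≤ 2 ^ d := Nat.lt_two_pow_self
    have hNpow : N = 2 ^ (t * d) := by rw [hN, hkdef, ← pow_mul]
    have h1 : N + C.size ≤ N * (1 + d * univBound k) := by
      have := hCs; nlinarith
    have h2 : 1 + d * univBound k ≤ 2 ^ d * 2 ^ (k + 3) := by
      have h21 : 1 + d * univBound k ≤ (d + 1) * 2 ^ (k + 3) := by
        have : 1 ≤ 2 ^ (k + 3) := Nat.one_le_two_pow
        nlinarith
      exact h21.trans (Nat.mul_le_mul_right _ hd2)
    have h3 : N + C.size ≤ 2 ^ (t * d + d + (k + 3)) := by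
      rw [pow_add, pow_add, ← hNpow, mul_assoc]
      exact h1.trans (Nat.mul_le_mul_left N h2)
    calc Nat.log 2 (N + C.size) ≤ Nat.log 2 (2 ^ (t * d + d + (k + 3))) := Nat.log_mono_right h3
      _ = t * d + d + (k + 3) := Nat.log_pow (by norm_num) _
      _ ≤ 4 * (k + d * (t + 1)) := by nlinarith
  · -- depth: `d k ≤ depth + d (c d (t+1))` and `(c d² + c₀ d)(t+1) < k`, `d = c₀ + 1`
    have h1 := hlb P hP
    rw [hlog] at h1
    have e1 : d * k = c₀ * k + k := by rw [hd]; ring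
    have e2 : c₀ * (k + d * (t + 1)) = c₀ * k + c₀ * d * (t + 1) := by ring
    rw [e2]
    rw [e1] at h1
    rw [hsplit] at ht
    omega

end Summit.PneNP.PneNP.Theorems.KrwCompositionIteration
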